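import Literature.NumberTheory.Sieve.SieveFrameworkProofs
import HarnessLib

/-!
# Sieve dimension of a density with boundedly many classes per prime

Topic `Literature/NumberTheory/Sieve`.  Fully proved, no definition and no new fact.  If an
arithmetic function `g` satisfies `g(p) = c(p)/p` at the primes with `c(p) ≤ D` and `c(p) < p`, then
`g` satisfies the sieve-dimension condition `HasSieveDimension g (2D) K_D` of `SieveFramework.lean`
(Iwaniec's `Ω(κ)`; Halberstam–Richert, *Sieve Methods*, Ch. 2, `Ω₂(κ)`; Friedlander–Iwaniec,
*Opera de Cribro*, (5.38)) with the explicit constant `K_D = (2D+1)^{2D+1} e^{2D(9/2 + 6/log 2)}`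
depending on `D` only (`BoundedClassDensity.hasSieveDimension_of_card_le`).  This is the computation
of `PolyPrimeCountBrun.hasSieveDimension_rootDensity_of_le`
(`AletheiaZomleferFukshanskyGarcia2020ApplicationsBrunSieveProofs.lean`, there for the root-count
density `ω_F(p)/p` of one polynomial) for an ABSTRACT density, so that it applies to sieves by
arbitrary prescribed residue classes (first client: `IntervalResidueClassSieve.lean`).  Also recorded:
an arithmetic function of the shape `g(d) = ∏_{p ∣ d} c(p)` (`d ≠ 0`) is multiplicative
(`BoundedClassDensity.isMultiplicative_of_apply_eq_prod`).

Proof: termwise `(1 − c/p)⁻¹ ≤ p ≤ 2D + 1` for `p ≤ 2D` and `(1 − c/p)⁻¹ ≤ e^{2D/p}` for `p > 2D`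
(`(1 − t)⁻¹ ≤ e^{2t}` on `[0, 1/2]`), then Mertens over the window
(`sum_primesWindow_one_div_le`, `SieveFrameworkProofs.lean`).

## References

* H. Halberstam, H.-E. Richert, *Sieve Methods* (1974), Ch. 2 (`Ω₂(κ)`). [HalberstamRichert1974]
* J. Friedlander, H. Iwaniec, *Opera de Cribro* (2010), (5.38), §5.5. [FriedlanderIwaniecOpera2010]
-/

noncomputable section

open Finset

namespace Literature.NumberTheory.Sieve

namespace BoundedClassDensity

/-! ### Densities with boundedly many classes per prime -/

/-- An arithmetic function with `g(d) = ∏_{p ∣ d} c(p)` for `d ≠ 0` is multiplicative. [folklore] -/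
theorem isMultiplicative_of_apply_eq_prod {g : ArithmeticFunction ℝ} {c : ℕ → ℝ}
    (hg : ∀ d : ℕ, d ≠ 0 → g d = ∏ p ∈ d.primeFactors, c p) : g.IsMultiplicative := by
  refine ⟨?_, ?_⟩
  · rw [hg 1 one_ne_zero, Nat.primeFactors_one, Finset.prod_empty]
  · intro m n hmn
    rcases Nat.eq_zero_or_pos m with rfl | hm
    · simp
    rcases Nat.eq_zero_or_pos n with rfl | hn
    · simp
    rw [hg _ (Nat.mul_ne_zero hm.ne' hn.ne'), hg _ hm.ne', hg _ hn.ne',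
      Nat.primeFactors_mul hm.ne' hn.ne', Finset.prod_union hmn.disjoint_primeFactors]

/-- **Densities with at most `D` classes per prime have sieve dimension `2D`, uniformly.** If
`g(p) = c(p)/p` with `c(p) ≤ D` and `c(p) < p` at every prime `p`, then `0 ≤ g(p) < 1` and, for
`2 ≤ w ≤ z`, `∏_{w ≤ p < z} (1 − g(p))⁻¹ ≤ K_D (log z/log w)^{2D}` with
`K_D = (2D+1)^{2D+1} e^{2D(9/2 + 6/log 2)}` (termwise `(1 − c/p)⁻¹ ≤ p ≤ 2D + 1` for `p ≤ 2D` and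
`(1 − c/p)⁻¹ ≤ e^{2D/p}` for `p > 2D`, then Mertens over the window,
`sum_primesWindow_one_div_le`); the computation of
`PolyPrimeCountBrun.hasSieveDimension_rootDensity_of_le` for an abstract density
(Halberstam–Richert Ch. 2, condition `Ω₂(κ)`; Friedlander–Iwaniec (5.38)). [folklore] -/
theorem hasSieveDimension_of_card_le {g : ArithmeticFunction ℝ} {c : ℕ → ℕ} {D : ℕ}
    (hg : ∀ p : ℕ, p.Prime → g p = (c p : ℝ) / p)
    (hle : ∀ p : ℕ, p.Prime → c p ≤ D) (hlt : ∀ p : ℕ, p.Prime → c p < p) :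
    HasSieveDimension g (2 * D)
      (((2 * D + 1 : ℕ) : ℝ) ^ (2 * D + 1) * Real.exp (2 * D * (9 / 2 + 6 / Real.log 2))) := by
  have hg01 : ∀ p : ℕ, p.Prime → 0 ≤ g p ∧ g p < 1 := by
    intro p hp
    rw [hg p hp]
    refine ⟨by positivity, ?_⟩
    rw [div_lt_one (by exact_mod_cast hp.pos)]
    exact_mod_cast hlt p hp
  refine ⟨hg01, fun w z hw hwz => ?_⟩
  set S := (Nat.primesBelow ⌈z⌉₊).filter (fun p : ℕ => w ≤ (p : ℝ)) with hS
  have hlogw : 0 < Real.log w := Real.log_pos (by linarith)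
  have hlogz : 0 < Real.log z := Real.log_pos (by linarith)
  have hprime : ∀ p ∈ S, p.Prime := fun p hp =>
    (Nat.mem_primesBelow.mp (Finset.mem_filter.mp hp).1).2
  set M : ℝ := ((2 * D + 1 : ℕ) : ℝ) with hM
  have hM1 : 1 ≤ M := by rw [hM]; exact_mod_cast Nat.succ_le_succ (Nat.zero_le _)
  set E : ℕ → ℝ := fun p => Real.exp (2 * D * (1 / (p : ℝ))) with hE
  -- termwise bound
  have hpt : ∀ p ∈ S, (1 - g p)⁻¹ ≤ (if p ≤ 2 * D then M else 1) * E p := by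
    intro p hp
    have hpp : p.Prime := hprime p hp
    have hp0 : (0 : ℝ) < p := by exact_mod_cast hpp.pos
    have hE1 : 1 ≤ E p := Real.one_le_exp (by positivity)
    have hρD : (c p : ℝ) ≤ D := by exact_mod_cast hle p hpp
    have hρp : (c p : ℝ) + 1 ≤ p := by exact_mod_cast Nat.succ_le_of_lt (hlt p hpp)
    rw [hg p hpp]
    by_cases hpD : p ≤ 2 * D
    · rw [if_pos hpD]
      have h1 : 1 - (c p : ℝ) / p = ((p : ℝ) - c p) / p := by
        field_simp
      have hden : (1 : ℝ) ≤ (p : ℝ) - c p := by linarith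
      calc (1 - (c p : ℝ) / p)⁻¹
          = p / ((p : ℝ) - c p) := by rw [h1, inv_div]
        _ ≤ p := div_le_self hp0.le hden
        _ ≤ M := by rw [hM]; exact_mod_cast (by omega : p ≤ 2 * D + 1)
        _ ≤ M * E p := le_mul_of_one_le_right (by linarith) hE1
    · rw [if_neg hpD, one_mul]
      push Not at hpD
      set t : ℝ := (c p : ℝ) / p with ht
      have ht0 : 0 ≤ t := by positivity
      have h2D : (2 * D : ℝ) < p := by exact_mod_cast hpD
      have ht2 : t ≤ 1 / 2 := by
        rw [ht, div_le_iff₀ hp0]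
        linarith
      have htD : t ≤ D * (1 / (p : ℝ)) := by
        rw [ht, mul_one_div]
        exact div_le_div_of_nonneg_right hρD hp0.le
      -- `(1 - t)⁻¹ ≤ e^{2t}` for `0 ≤ t ≤ 1/2`, since `(1 + 2t)(1 - t) ≥ 1` there
      have hinv : (1 - t)⁻¹ ≤ Real.exp (2 * t) := by
        have h1t : 0 < 1 - t := by linarith
        rw [inv_eq_one_div, div_le_iff₀ h1t]
        have hA : (2 * t + 1) * (1 - t) ≤ Real.exp (2 * t) * (1 - t) :=
          mul_le_mul_of_nonneg_right (Real.add_one_le_exp _) h1t.le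
        have hB : 1 ≤ (2 * t + 1) * (1 - t) := by nlinarith
        linarith
      calc (1 - t)⁻¹ ≤ Real.exp (2 * t) := hinv
        _ ≤ E p := Real.exp_le_exp.mpr (by linarith)
  have hnonneg : ∀ p ∈ S, 0 ≤ (1 - g p)⁻¹ := fun p hp =>
    inv_nonneg.mpr (sub_nonneg.mpr (hg01 p (hprime p hp)).2.le)
  have hsum1 : ∑ p ∈ S, (1 : ℝ) / p ≤
      Real.log (Real.log z) - Real.log (Real.log w) + (9 / 2 + 6 / Real.log 2) :=
    sum_primesWindow_one_div_le hw hwz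
  have hprodM : ∏ p ∈ S, (if p ≤ 2 * D then M else 1) ≤ M ^ (2 * D + 1) := by
    rw [Finset.prod_ite, Finset.prod_const_one, mul_one, Finset.prod_const]
    refine pow_le_pow_right₀ hM1 ?_
    calc #(S.filter fun p => p ≤ 2 * D) ≤ #(range (2 * D + 1)) :=
          card_le_card fun p hp => by
            rw [mem_filter] at hp
            rw [mem_range]
            omega
      _ = 2 * D + 1 := card_range _
  have hprodE : ∏ p ∈ S, E p = Real.exp (2 * D * ∑ p ∈ S, (1 : ℝ) / p) := by
    rw [Finset.mul_sum, Real.exp_sum]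
  have hLL : Real.exp (Real.log (Real.log z) - Real.log (Real.log w)) =
      Real.log z / Real.log w := by
    rw [Real.exp_sub, Real.exp_log hlogz, Real.exp_log hlogw]
  have hexp : Real.exp (2 * D * ∑ p ∈ S, (1 : ℝ) / p) ≤
      Real.exp (2 * D * (9 / 2 + 6 / Real.log 2)) *
        (Real.log z / Real.log w) ^ (2 * (D : ℝ)) := by
    have hD0 : (0 : ℝ) ≤ 2 * D := by positivity
    calc Real.exp (2 * D * ∑ p ∈ S, (1 : ℝ) / p)
        ≤ Real.exp (2 * D * (Real.log (Real.log z) - Real.log (Real.log w) +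
            (9 / 2 + 6 / Real.log 2))) :=
          Real.exp_le_exp.mpr (mul_le_mul_of_nonneg_left hsum1 hD0)
      _ = Real.exp (2 * D * (9 / 2 + 6 / Real.log 2)) *
            (Real.log z / Real.log w) ^ (2 * (D : ℝ)) := by
          have e1 : 2 * (D : ℝ) * (Real.log (Real.log z) - Real.log (Real.log w) +
              (9 / 2 + 6 / Real.log 2)) = 2 * D * (9 / 2 + 6 / Real.log 2) +
                ((2 * D : ℕ) : ℝ) * (Real.log (Real.log z) - Real.log (Real.log w)) := by
            push_cast; ring
          have e2 : (2 * (D : ℝ)) = ((2 * D : ℕ) : ℝ) := by push_cast; ring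
          rw [e1, Real.exp_add, Real.exp_nat_mul, hLL, e2, Real.rpow_natCast]
  calc ∏ p ∈ S, (1 - g p)⁻¹
      ≤ ∏ p ∈ S, ((if p ≤ 2 * D then M else 1) * E p) := Finset.prod_le_prod hnonneg hpt
    _ = (∏ p ∈ S, (if p ≤ 2 * D then M else 1)) * ∏ p ∈ S, E p := Finset.prod_mul_distrib
    _ ≤ M ^ (2 * D + 1) * ∏ p ∈ S, E p :=
        mul_le_mul_of_nonneg_right hprodM (Finset.prod_nonneg fun p _ => (Real.exp_pos _).le)
    _ ≤ M ^ (2 * D + 1) * (Real.exp (2 * D * (9 / 2 + 6 / Real.log 2)) *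
          (Real.log z / Real.log w) ^ (2 * (D : ℝ))) := by
        rw [hprodE]
        exact mul_le_mul_of_nonneg_left hexp (by positivity)
    _ = M ^ (2 * D + 1) * Real.exp (2 * D * (9 / 2 + 6 / Real.log 2)) *
          (Real.log z / Real.log w) ^ (2 * (D : ℝ)) := by ring

end BoundedClassDensity

end Literature.NumberTheory.Sieve
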